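/-
Copyright (c) 2026. All rights reserved.
Released under Apache 2.0 license as described in the file LICENSE.
-/
import Literature.NumberTheory.ComplexMultiplication.DegenerateCMTypesElementaryAbelianTitsworth
import HarnessLib

/-!
# CM types on the elementary abelian group of order `32`: the Kubota rank is `2`, `5`, `9`, `11` or `17` — the
# BALANCE of the sign counts along an even character, and the rank spectrum of the multiquadratic CM fields of
# degree `32`

Setting of the tree's `DegenerateCMTypesElementaryAbelianTwoGroup` (seat p10 g37-#3; T. Kubota [Kubota1965] §4
Lemma 2 = B. B. Gordon [Gordon1999HodgeAVSurvey] Prop. 9.4.1, `rank(T) = 1 + #{χ odd : Ŝ(χ) ≠ 0}`) on a finite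
commutative group `G` of EXPONENT `2`, `T` a CM type w.r.t. `ρ`, `Ŝ(χ) = Σ_{t∈T} χ(t) = |T| − 2a_χ(T)` with the sign
counts `a_χ(T) = #{t ∈ T : χ(t) = −1}` (B. Dodson's weights [Dodson1984] §3.1.1).  The tree knows: all `a_χ(T)`,
`χ` odd, have a common parity (`8 ∣ |G|`); odd types have full rank; Parseval `Σ_{χ odd} Ŝ(χ)² = |T|²`; the spectra
`{5, 2}` (order `8`) and `{9, 5, 2}` (order `16`); and (g38-#3) no rank `3` or `4` in any order.  Order `32` is the
first where Parseval and parity leave undecided candidates (`6, 8, 14`); THIS FILE settles it with one more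
invariant, the BALANCE of the sign counts along an even character:

> **Balance lemma** (`card_filter_filter_mod_two_eq`, `16 ∣ |G|`).  For an even character `λ ≠ 1` put
> `T₀ = {t ∈ T : λ(t) = 1}` (`|T₀| = |G|/4`).  Then the counts `a_χ(T₀) = #{t ∈ T₀ : χ(t) = −1}`, `χ` odd, all have
> the SAME parity.  Since `Ŝ(χ) + Ŝ(χλ) = 2(|T₀| − 2a_χ(T₀))` (`sum_char_add_sum_char_add_eq`), for an even type in
> order `32` (`Ŝ = 4k`) the parity of `k(χ) + k(χλ)` does not depend on `χ`: the residues `a_χ(T) mod 4` are either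
> CONSTANT along every `λ`-pair or ALTERNATE along every `λ`-pair, whence (`card_filter_mod_four_mem`)
> `#{χ odd : a_χ(T) ≡ 2 (mod 4)} ∈ {0, 8, 16}`.
> **Theorem** (`typeRank_mem_of_card_thirtytwo`).  On a finite commutative group of exponent `2` and order `32`,
> every CM type has Kubota rank `2, 5, 9, 11` or `17`.

(Parseval in order `32` reads `16·n₆₄ + 9·n₃₆ + 4·n₁₆ + n₄ = 16` for the numbers `n_v` of odd characters with
`(8 − a_χ)² = v`; the balance `n₃₆ + n₄ ∈ {0, 8, 16}` leaves exactly the solutions with `16 − n₀ ∈ {1, 4, 8, 10, 16}`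
survivors.  In Boolean terms — CM types on `⟨ρ⟩ × 𝔽₂⁴` are the Boolean functions of FOUR variables, Kubota's
survivors their Walsh supports, C. Carlet [Carlet2020] §2.3 — the Walsh support of a `4`-variable Boolean function
has `1, 4, 8, 10` or `16` elements; all five values occur, e.g. for `0`, `x₁x₂`, `x₁x₂x₃`, `x₁x₂x₃ + x₁x₄`,
`x₁x₂ + x₃x₄` — existence is not formalised here.)

* §1 (every order) `four_mul_card_filter_and_eq` (`4·#{λ = 1, ψ = −1} = |G|` for distinct non-trivial `λ, ψ`),
  `eight_mul_card_filter_and_eq` (`8·#{t ∈ T : λ(t) = 1, ψ(t) = −1} = |G|` for distinct even non-trivial `λ, ψ`),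
  `four_mul_card_filter_eq_one_eq` (`|T₀| = |G|/4`), `sum_char_add_sum_char_add_eq`,
  **`card_filter_filter_mod_two_eq`** (balance, `16 ∣ |G|`).
* §2 (order `32`) `two_mul_card_odd_eq` (`16` odd characters), **`card_filter_mod_four_mem`**,
  **`typeRank_mem_of_card_thirtytwo`**, `typeRank_ne_six/eight/fourteen_of_card_thirtytwo`,
  `typeRank_eq_seventeen_or_le_eleven_of_card_thirtytwo`.

HONEST SCOPE.  Elementary character sums on Kubota's formula; the sources print the rank formula (Kubota, Gordon),
the weights (Dodson) and the Walsh-transform calculus (Carlet); the balance invariant and the order-`32` spectrum are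
this file's regrouping (for Boolean functions of four variables the list of Walsh supports is classical folklore of
the Berlekamp–Welch classification, not cited as a source here).  The existence of types of each rank and the field
dress (multiquadratic CM fields of degree `32`) are left to sequels.  THEOREMS ONLY: no definition, no named fact,
no instance, no `sorry`.

## References

* [Kubota1965] T. Kubota, *On the field extension by complex multiplication*, Trans. AMS 118 (1965), §4 Lemma 2.
* [Gordon1999HodgeAVSurvey] B. B. Gordon, *A survey of the Hodge conjecture for abelian varieties*, Prop. 9.4.1.
* [Dodson1984] B. Dodson, *The structure of Galois groups of CM-fields*, Trans. AMS 283 (1984), §3.1.1 Theorem.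
* [Carlet2020] C. Carlet, *Boolean Functions for Cryptography and Coding Theory*, CUP, §2.3 ((2.47) Parseval,
  (2.51) Titsworth, p. 61).

## Provenance

Lane `lit-hodgefound` (Track 2, Layer A3), seat `lit-hodgefound-p10` generation 38, row g38-#6; neighbours cited by
name, nothing restated: `DegenerateCMTypesElementaryAbelianTwoGroup` (`sum_char_eq_card_sub_two_mul`,
`sum_char_eq_zero_iff_two_mul_card_filter_eq`, `two_mul_card_filter_univ_eq`, `four_mul_card_filter_eq`,
`card_filter_mod_two_eq`, `typeRank_eq_of_odd`, `sum_odd_sq_eq_int`, `exists_odd_sum_char_ne_zero`),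
`DegenerateCMTypesElementaryAbelianTitsworth` (`add_self_eq_zero_char`), `CMTypeRankCharacters`
(`IsCMTypeWith.typeRank_eq_one_add_ncard_oddCharacters`), `Pohlmann1968/CMTypeRankCharactersNumberField`
(`two_mul_ncard_oddCharacters_eq_card`), `CMTypeElementaryTwoGroupOddWeights` (`character_apply_eq_one_or_of_mul_self`,
`sum_character_eq_zero_of_ne_zero`).
-/

open scoped BigOperators Classical

namespace Literature.NumberTheory.ComplexMultiplication

namespace CyclicCMType

namespace ExponentTwo

variable {G : Type*} [CommGroup G] [Fintype G] [DecidableEq G] {ρ : G} {T : Finset G}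

/-! ## §0 Helpers -/

section Helpers

omit [Fintype G] [DecidableEq G] in
/-- `g·g = 1` in exponent `2`. [folklore] -/
private theorem mul_self_eq_one_tt (hexp : ∀ g : G, g ^ 2 = 1) (g : G) : g * g = 1 := by
  rw [← pow_two]; exact hexp g

omit [Fintype G] [DecidableEq G] in
/-- Characters of a group of exponent `2` are `±1`-valued. [cite: Kubota1965, §4 Lemma 2 (proof)] -/
private theorem char_eq_one_or_tt (hexp : ∀ g : G, g ^ 2 = 1) (χ : AddChar (Additive G) ℂ) (g : G) :
    χ (Additive.ofMul g) = 1 ∨ χ (Additive.ofMul g) = -1 :=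
  character_apply_eq_one_or_of_mul_self χ (mul_self_eq_one_tt hexp g)

omit [Fintype G] [DecidableEq G] in
/-- `χ(gh) = χ(g)χ(h)`. [folklore] -/
private theorem char_mul_tt (χ : AddChar (Additive G) ℂ) (g h : G) :
    χ (Additive.ofMul (g * h)) = χ (Additive.ofMul g) * χ (Additive.ofMul h) := by
  rw [ofMul_mul, AddChar.map_add_eq_mul]

omit [DecidableEq G] in
/-- `Σ_{g∈G} χ(g) = |G|·[χ = 1]`. [folklore] -/
private theorem sum_char_univ_eq_ite_tt (χ : AddChar (Additive G) ℂ) :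
    ∑ g : G, χ (Additive.ofMul g) = if χ = 0 then (Fintype.card G : ℂ) else 0 := by
  by_cases h0 : χ = 0
  · rw [if_pos h0, h0]
    simp only [AddChar.zero_apply, Finset.sum_const, Finset.card_univ, nsmul_eq_mul, mul_one]
  · rw [if_neg h0, sum_character_eq_zero_of_ne_zero h0]

omit [Fintype G] [DecidableEq G] in
/-- In exponent `2`: `λ + ψ = 0 ⟺ ψ = λ`. [folklore] -/
private theorem add_eq_zero_iff_eq_tt (hexp : ∀ g : G, g ^ 2 = 1) (lam ψ : AddChar (Additive G) ℂ) :
    lam + ψ = 0 ↔ ψ = lam := by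
  have hll := add_self_eq_zero_char hexp lam
  constructor
  · intro h0
    have : lam + ψ = lam + lam := by rw [h0, hll]
    exact add_left_cancel this
  · intro h0; rw [h0, hll]

omit [Fintype G] [DecidableEq G] in
/-- `ρ² = 1`. [folklore] -/
private theorem rho_mul_rho_tt (h : IsCMTypeWith ρ (T : Set G)) : ρ * ρ = 1 := by
  have := h.invol (1 : G)
  simpa [smul_eq_mul] using this

omit [Fintype G] [DecidableEq G] in
/-- `ρ ≠ 1`. [folklore] -/
private theorem rho_ne_one_tt (h : IsCMTypeWith ρ (T : Set G)) : ρ ≠ 1 := by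
  intro hρ
  have := h.rho_smul_ne (1 : G)
  rw [hρ, smul_eq_mul, one_mul] at this
  exact this rfl

omit [Fintype G] [DecidableEq G] in
/-- `ρx ∈ T ⟺ x ∉ T`. [folklore] -/
private theorem rho_mul_mem_iff_tt (h : IsCMTypeWith ρ (T : Set G)) (x : G) : ρ * x ∈ T ↔ x ∉ T := by
  have := h.rho_smul_mem_iff x
  simpa only [smul_eq_mul, Finset.mem_coe] using this

/-- `G ∖ T = ρT`. [folklore] -/
private theorem compl_eq_image_tt (h : IsCMTypeWith ρ (T : Set G)) : Tᶜ = T.image fun s => ρ * s := by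
  ext x
  rw [Finset.mem_compl, Finset.mem_image]
  constructor
  · intro hx
    refine ⟨ρ * x, (rho_mul_mem_iff_tt h x).2 hx, ?_⟩
    rw [← mul_assoc, rho_mul_rho_tt h, one_mul]
  · rintro ⟨s, hs, rfl⟩
    exact fun hx => ((rho_mul_mem_iff_tt h s).1 hx) hs

/-- `|G| = 2|T|`. [folklore] -/
private theorem two_mul_card_tt (h : IsCMTypeWith ρ (T : Set G)) : 2 * T.card = Fintype.card G := by
  have hinj : Function.Injective fun s : G => ρ * s := fun a b hab => mul_left_cancel hab
  have h1 : Tᶜ.card = T.card := by rw [compl_eq_image_tt h, Finset.card_image_of_injective _ hinj]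
  have h2 := Finset.card_add_card_compl T
  omega

omit [DecidableEq G] in
/-- The set of surviving odd characters as a finset. [cite: Kubota1965, §4 Lemma 2] -/
private theorem ncard_survivors_eq_tt (T : Finset G) (ρ : G) :
    {χ : AddChar (Additive G) ℂ | χ (Additive.ofMul ρ) = -1 ∧ ∑ s ∈ T, χ (Additive.ofMul s) ≠ 0}.ncard =
      ((Finset.univ.filter fun χ : AddChar (Additive G) ℂ => χ (Additive.ofMul ρ) = -1).filter
        fun χ => ∑ s ∈ T, χ (Additive.ofMul s) ≠ 0).card := by
  rw [← Set.ncard_coe_finset]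
  congr 1
  ext χ
  simp only [Set.mem_setOf_eq, Finset.coe_filter, Finset.mem_filter, Finset.mem_univ, true_and]

end Helpers

/-! ## §1 Joint counts of two characters, the half-type `T₀ = {t ∈ T : λ(t) = 1}`, and the balance lemma -/

section Balance

omit [DecidableEq G] in
/-- **`4·#{g : λ(g) = 1, ψ(g) = −1} = |G|`** for non-trivial characters `λ ≠ ψ` of a group of exponent `2`
(expand `Σ_g (1 + λ(g))(1 − ψ(g))`; `λψ ≠ 1`). [cite: Kubota1965, §4 Lemma 2 (proof)] -/
theorem four_mul_card_filter_and_eq (hexp : ∀ g : G, g ^ 2 = 1) {lam ψ : AddChar (Additive G) ℂ} (hl : lam ≠ 0)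
    (hψ : ψ ≠ 0) (hne : ψ ≠ lam) :
    4 * (Finset.univ.filter fun g : G => lam (Additive.ofMul g) = 1 ∧ ψ (Additive.ofMul g) = -1).card =
      Fintype.card G := by
  have hkey : ∀ g : G, (1 + lam (Additive.ofMul g)) * (1 - ψ (Additive.ofMul g)) =
      if lam (Additive.ofMul g) = 1 ∧ ψ (Additive.ofMul g) = -1 then (4 : ℂ) else 0 := by
    intro g
    rcases char_eq_one_or_tt hexp lam g with h1 | h1 <;> rcases char_eq_one_or_tt hexp ψ g with h2 | h2 <;>
      simp only [h1, h2] <;> norm_num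
  have hsum : ∑ g : G, (1 + lam (Additive.ofMul g)) * (1 - ψ (Additive.ofMul g)) =
      4 * ((Finset.univ.filter fun g : G => lam (Additive.ofMul g) = 1 ∧ ψ (Additive.ofMul g) = -1).card : ℂ) := by
    rw [Finset.sum_congr rfl fun g _ => hkey g, ← Finset.sum_filter, Finset.sum_const, nsmul_eq_mul, mul_comm]
  have hexpand : ∑ g : G, (1 + lam (Additive.ofMul g)) * (1 - ψ (Additive.ofMul g)) =
      ∑ g : G, (1 : ℂ) + ∑ g : G, lam (Additive.ofMul g) - ∑ g : G, ψ (Additive.ofMul g) -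
        ∑ g : G, (lam + ψ) (Additive.ofMul g) := by
    rw [← Finset.sum_add_distrib, ← Finset.sum_sub_distrib, ← Finset.sum_sub_distrib]
    refine Finset.sum_congr rfl fun g _ => ?_
    rw [AddChar.add_apply]; ring
  have hlψ : lam + ψ ≠ 0 := fun h0 => hne ((add_eq_zero_iff_eq_tt hexp lam ψ).1 h0)
  rw [hexpand, sum_char_univ_eq_ite_tt, sum_char_univ_eq_ite_tt, sum_char_univ_eq_ite_tt, if_neg hl, if_neg hψ,
    if_neg hlψ, Finset.sum_const, Finset.card_univ, nsmul_eq_mul, mul_one] at hsum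
  have : ((Fintype.card G : ℕ) : ℂ) = ((4 * (Finset.univ.filter fun g : G =>
      lam (Additive.ofMul g) = 1 ∧ ψ (Additive.ofMul g) = -1).card : ℕ) : ℂ) := by
    push_cast; linear_combination hsum
  exact (Nat.cast_injective this).symm

/-- **`8·#{t ∈ T : λ(t) = 1, ψ(t) = −1} = |G|`** for a CM type `T` and distinct EVEN non-trivial characters `λ, ψ`:
the set `{λ = 1, ψ = −1}` (`|G|/4` elements) is `ρ`-stable and `T ⊔ ρT = G` takes half of it.
[cite: Kubota1965, §4 Lemma 2 (proof)] -/
theorem eight_mul_card_filter_and_eq (hexp : ∀ g : G, g ^ 2 = 1) (h : IsCMTypeWith ρ (T : Set G))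
    {lam ψ : AddChar (Additive G) ℂ} (hlρ : lam (Additive.ofMul ρ) = 1) (hl : lam ≠ 0)
    (hψρ : ψ (Additive.ofMul ρ) = 1) (hψ : ψ ≠ 0) (hne : ψ ≠ lam) :
    8 * (T.filter fun t => lam (Additive.ofMul t) = 1 ∧ ψ (Additive.ofMul t) = -1).card = Fintype.card G := by
  have hinj : Function.Injective fun s : G => ρ * s := fun a b hab => mul_left_cancel hab
  set P : G → Prop := fun t => lam (Additive.ofMul t) = 1 ∧ ψ (Additive.ofMul t) = -1 with hP
  have hPρ : ∀ x : G, P (ρ * x) ↔ P x := fun x => by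
    simp only [hP, char_mul_tt, hlρ, hψρ, one_mul]
  have himg : Tᶜ.filter P = (T.filter P).image (fun s => ρ * s) := by
    ext x
    simp only [Finset.mem_filter, Finset.mem_compl, Finset.mem_image]
    constructor
    · rintro ⟨hx, hPx⟩
      refine ⟨ρ * x, ⟨(rho_mul_mem_iff_tt h x).2 hx, (hPρ x).2 hPx⟩, ?_⟩
      rw [← mul_assoc, rho_mul_rho_tt h, one_mul]
    · rintro ⟨s, ⟨hs, hPs⟩, rfl⟩
      exact ⟨fun hx => (rho_mul_mem_iff_tt h s).1 hx hs, (hPρ s).2 hPs⟩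
  have hT : (Tᶜ.filter P).card = (T.filter P).card := by rw [himg, Finset.card_image_of_injective _ hinj]
  have hsplit : (T.filter P).card + (Tᶜ.filter P).card = (Finset.univ.filter P).card := by
    rw [← Finset.card_union_of_disjoint (Finset.disjoint_filter_filter disjoint_compl_right),
      ← Finset.filter_union, Finset.union_compl]
  have h4 := four_mul_card_filter_and_eq hexp hl hψ hne
  simp only [hP] at hsplit hT h4 ⊢
  omega

/-- **`|T₀| = |G|/4`** for `T₀ = {t ∈ T : λ(t) = 1}`, `λ` even and non-trivial: `4·#T₀ = |G|` (`λ = −1` on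
exactly `|G|/4` elements of `T`, tree `four_mul_card_filter_eq`, and `|T| = |G|/2`). [cite: Kubota1965, §4 Lemma 2] -/
theorem four_mul_card_filter_eq_one_eq (hexp : ∀ g : G, g ^ 2 = 1) (h : IsCMTypeWith ρ (T : Set G))
    {lam : AddChar (Additive G) ℂ} (hlρ : lam (Additive.ofMul ρ) = 1) (hl : lam ≠ 0) :
    4 * (T.filter fun t => lam (Additive.ofMul t) = 1).card = Fintype.card G := by
  have h1 := four_mul_card_filter_eq hexp h hlρ hl
  have hsplit := Finset.card_filter_add_card_filter_not (s := T) (fun t => lam (Additive.ofMul t) = 1)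
  have hnot : (T.filter fun t => ¬ lam (Additive.ofMul t) = 1) = T.filter fun t => lam (Additive.ofMul t) = -1 := by
    refine Finset.filter_congr fun t _ => ?_
    rcases char_eq_one_or_tt hexp lam t with h2 | h2
    · rw [h2]; norm_num
    · rw [h2]; norm_num
  rw [hnot] at hsplit
  have hT := two_mul_card_tt h
  omega

omit [Fintype G] [DecidableEq G] in
/-- **`Ŝ(χ) + Ŝ(χλ) = 2·Σ_{T₀} χ`** (`χ(t) + χ(t)λ(t) = 2χ(t)·[λ(t) = 1]`). [cite: Kubota1965, §4 Lemma 2 (proof)] -/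
theorem sum_char_add_sum_char_add_eq (hexp : ∀ g : G, g ^ 2 = 1) (χ lam : AddChar (Additive G) ℂ)
    (S : Finset G) :
    ∑ s ∈ S, χ (Additive.ofMul s) + ∑ s ∈ S, (χ + lam) (Additive.ofMul s) =
      2 * ∑ s ∈ S.filter (fun t => lam (Additive.ofMul t) = 1), χ (Additive.ofMul s) := by
  rw [← Finset.sum_add_distrib, Finset.sum_filter, Finset.mul_sum]
  refine Finset.sum_congr rfl fun s _ => ?_
  rw [AddChar.add_apply]
  rcases char_eq_one_or_tt hexp lam s with h1 | h1
  · rw [h1, if_pos rfl]; ring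
  · rw [h1, if_neg (by norm_num)]; ring

/-- **THE BALANCE LEMMA**: on a group of exponent `2` with `16 ∣ |G|`, for a CM type `T`, an even character `λ ≠ 1`
and `T₀ = {t ∈ T : λ(t) = 1}`, the counts `a_χ(T₀) = #{t ∈ T₀ : χ(t) = −1}` over the ODD characters `χ` all have
the same parity: for odd `χ, χ'` with `χχ' ∉ {1, λ}`, `a_χ(T₀) + a_{χ'}(T₀) = #{t ∈ T₀ : χχ'(t) = −1} + 2·#{both} =
|G|/8 + 2·#{both}`. [cite: Kubota1965, §4 Lemma 2] [cite: Dodson1984, §3.1.1 Theorem] -/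
theorem card_filter_filter_mod_two_eq (hexp : ∀ g : G, g ^ 2 = 1) (h : IsCMTypeWith ρ (T : Set G))
    (h16 : 16 ∣ Fintype.card G) {lam : AddChar (Additive G) ℂ} (hlρ : lam (Additive.ofMul ρ) = 1) (hl : lam ≠ 0)
    {χ χ' : AddChar (Additive G) ℂ} (hχ : χ (Additive.ofMul ρ) = -1) (hχ' : χ' (Additive.ofMul ρ) = -1) :
    ((T.filter fun t => lam (Additive.ofMul t) = 1).filter fun t => χ (Additive.ofMul t) = -1).card % 2 =
      ((T.filter fun t => lam (Additive.ofMul t) = 1).filter fun t => χ' (Additive.ofMul t) = -1).card % 2 := by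
  set T₀ := T.filter (fun t => lam (Additive.ofMul t) = 1) with hT₀
  by_cases heq : χ' = χ
  · rw [heq]
  by_cases hlam : χ' = χ + lam
  · -- on `T₀`, `χ' = χ`
    have : T₀.filter (fun t => χ' (Additive.ofMul t) = -1) = T₀.filter (fun t => χ (Additive.ofMul t) = -1) := by
      refine Finset.filter_congr fun t ht => ?_
      have hlt : lam (Additive.ofMul t) = 1 := (Finset.mem_filter.1 ht).2
      rw [hlam, AddChar.add_apply, hlt, mul_one]
    rw [this]
  -- otherwise `ψ = χχ'` is even, non-trivial, `≠ λ`
  set ψ := χ + χ' with hψ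
  have hψρ : ψ (Additive.ofMul ρ) = 1 := by rw [hψ, AddChar.add_apply, hχ, hχ']; norm_num
  have hψ0 : ψ ≠ 0 := by
    intro h0
    exact heq (((add_eq_zero_iff_eq_tt hexp χ χ').1 h0))
  have hψl : ψ ≠ lam := by
    intro h0
    apply hlam
    -- `χ + χ' = λ` ⟹ `χ' = χ + λ`
    have hcc := add_self_eq_zero_char hexp χ
    calc χ' = χ + χ + χ' := by rw [hcc, zero_add]
      _ = χ + lam := by rw [add_assoc, ← hψ, h0]
  -- the joint count on `T₀`
  have hjoint : 8 * (T₀.filter fun t => ψ (Additive.ofMul t) = -1).card = Fintype.card G := by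
    have := eight_mul_card_filter_and_eq hexp h hlρ hl hψρ hψ0 hψl
    rw [hT₀, Finset.filter_filter]
    exact this
  -- pointwise: `[χ = −1] + [χ' = −1] = [χχ' = −1] + 2[both]`
  have hpt : ∀ t : G, ((if χ (Additive.ofMul t) = -1 then 1 else 0 : ℕ) + if χ' (Additive.ofMul t) = -1 then 1 else 0) =
      (if ψ (Additive.ofMul t) = -1 then 1 else 0) +
        2 * (if χ (Additive.ofMul t) = -1 ∧ χ' (Additive.ofMul t) = -1 then 1 else 0) := by
    intro t
    have hψt : ψ (Additive.ofMul t) = χ (Additive.ofMul t) * χ' (Additive.ofMul t) := by rw [hψ, AddChar.add_apply]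
    rcases char_eq_one_or_tt hexp χ t with h1 | h1 <;> rcases char_eq_one_or_tt hexp χ' t with h2 | h2 <;>
      simp only [hψt, h1, h2] <;> norm_num
  have hsum := Finset.sum_congr (rfl : T₀ = T₀) fun t (_ : t ∈ T₀) => hpt t
  rw [Finset.sum_add_distrib, Finset.sum_add_distrib, ← Finset.mul_sum, Finset.sum_boole, Finset.sum_boole,
    Finset.sum_boole, Finset.sum_boole] at hsum
  simp only [Nat.cast_id] at hsum
  obtain ⟨c, hc⟩ := h16
  omega

end Balance

/-! ## §2 Order `32` -/

section ThirtyTwo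

omit [DecidableEq G] in
/-- `16` odd characters in order `32` (half of the `|G|` characters are odd). [cite: Kubota1965, §4 Lemma 2] -/
theorem two_mul_card_odd_eq (h : IsCMTypeWith ρ (T : Set G)) :
    2 * (Finset.univ.filter fun χ : AddChar (Additive G) ℂ => χ (Additive.ofMul ρ) = -1).card = Fintype.card G := by
  have h1 := Literature.AlgebraicGeometry.Pohlmann1968.two_mul_ncard_oddCharacters_eq_card
    (G := G) (rho_ne_one_tt h) (rho_mul_rho_tt h)
  have hset : {χ : AddChar (Additive G) ℂ | χ (Additive.ofMul ρ) = -1} =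
      ↑(Finset.univ.filter fun χ : AddChar (Additive G) ℂ => χ (Additive.ofMul ρ) = -1) := by
    ext χ; simp
  rw [hset, Set.ncard_coe_finset] at h1
  exact h1

omit [DecidableEq G] in
/-- **BALANCE IN ORDER `32`: `#{χ odd : a_χ(T) ≡ 2 (mod 4)} ∈ {0, 8, 16}`** for an EVEN CM type (all `a_χ(T)`
even).  If `χ₁, χ₂` are odd with `a_{χ₁} ≡ 2`, `a_{χ₂} ≢ 2 (mod 4)`, take `λ = χ₁χ₂`: from
`a_χ(T) + a_{χλ}(T) = 8 + 2a_χ(T₀)` and the balance lemma, `a_χ(T₀)` is odd for EVERY odd `χ`, so the residues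
alternate along every `λ`-pair and `χ ↦ χλ` matches the two classes. [cite: Kubota1965, §4 Lemma 2]
[cite: Dodson1984, §3.1.1 Theorem] -/
theorem card_filter_mod_four_mem (hexp : ∀ g : G, g ^ 2 = 1) (h : IsCMTypeWith ρ (T : Set G))
    (h32 : Fintype.card G = 32)
    (hev : ∀ χ : AddChar (Additive G) ℂ, χ (Additive.ofMul ρ) = -1 →
      Even (T.filter fun s => χ (Additive.ofMul s) = -1).card) :
    ((Finset.univ.filter fun χ : AddChar (Additive G) ℂ => χ (Additive.ofMul ρ) = -1).filter
        fun χ => (T.filter fun s => χ (Additive.ofMul s) = -1).card % 4 = 2).card = 0 ∨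
    ((Finset.univ.filter fun χ : AddChar (Additive G) ℂ => χ (Additive.ofMul ρ) = -1).filter
        fun χ => (T.filter fun s => χ (Additive.ofMul s) = -1).card % 4 = 2).card = 8 ∨
    ((Finset.univ.filter fun χ : AddChar (Additive G) ℂ => χ (Additive.ofMul ρ) = -1).filter
        fun χ => (T.filter fun s => χ (Additive.ofMul s) = -1).card % 4 = 2).card = 16 := by
  set O := Finset.univ.filter (fun χ : AddChar (Additive G) ℂ => χ (Additive.ofMul ρ) = -1) with hO
  set a : AddChar (Additive G) ℂ → ℕ := fun χ => (T.filter fun s => χ (Additive.ofMul s) = -1).card with ha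
  have hOcard : O.card = 16 := by
    have := two_mul_card_odd_eq (T := T) h; rw [← hO, h32] at this; omega
  have hmemO : ∀ χ, χ ∈ O ↔ χ (Additive.ofMul ρ) = -1 := fun χ => by
    rw [hO, Finset.mem_filter]; exact ⟨fun hh => hh.2, fun hh => ⟨Finset.mem_univ _, hh⟩⟩
  have hT : T.card = 16 := by have := two_mul_card_tt h; omega
  have hev' : ∀ χ : AddChar (Additive G) ℂ, χ (Additive.ofMul ρ) = -1 → Even (a χ) := hev
  set O₂ := O.filter (fun χ => a χ % 4 = 2) with hO₂
  by_cases hall : O₂ = O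
  · right; right; rw [hall, hOcard]
  by_cases hnone : O₂ = ∅
  · left; rw [hnone, Finset.card_empty]
  right; left
  -- pick `χ₁ ∈ O₂` and `χ₂ ∈ O ∖ O₂`
  obtain ⟨χ₁, hχ₁⟩ := Finset.nonempty_iff_ne_empty.2 hnone
  have hsub : O₂ ⊆ O := Finset.filter_subset _ _
  obtain ⟨χ₂, hχ₂O, hχ₂⟩ := Finset.exists_of_ssubset (lt_of_le_of_ne hsub hall)
  have hχ₁O : χ₁ ∈ O := hsub hχ₁
  have hχ₁ρ := (hmemO χ₁).1 hχ₁O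
  have hχ₂ρ := (hmemO χ₂).1 hχ₂O
  have hχ₁2 : a χ₁ % 4 = 2 := (Finset.mem_filter.1 hχ₁).2
  have hχ₂2 : a χ₂ % 4 ≠ 2 := fun h2 => hχ₂ (Finset.mem_filter.2 ⟨hχ₂O, h2⟩)
  -- `λ = χ₁χ₂`
  set lam := χ₁ + χ₂ with hlam
  have hlρ : lam (Additive.ofMul ρ) = 1 := by rw [hlam, AddChar.add_apply, hχ₁ρ, hχ₂ρ]; norm_num
  have hl0 : lam ≠ 0 := by
    intro h0
    have : χ₂ = χ₁ := (add_eq_zero_iff_eq_tt hexp χ₁ χ₂).1 h0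
    rw [this] at hχ₂2
    exact hχ₂2 hχ₁2
  set T₀ := T.filter (fun t => lam (Additive.ofMul t) = 1) with hT₀
  have hT₀card : T₀.card = 8 := by
    have := four_mul_card_filter_eq_one_eq hexp h hlρ hl0; rw [← hT₀, h32] at this; omega
  set a₀ : AddChar (Additive G) ℂ → ℕ := fun χ => (T₀.filter fun t => χ (Additive.ofMul t) = -1).card with ha₀
  -- `a(χ) + a(χλ) = 8 + 2a₀(χ)`
  have hpair : ∀ χ : AddChar (Additive G) ℂ, a χ + a (χ + lam) = 8 + 2 * a₀ χ := by
    intro χ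
    have h1 := sum_char_add_sum_char_add_eq hexp χ lam T
    rw [sum_char_eq_card_sub_two_mul hexp χ T, sum_char_eq_card_sub_two_mul hexp (χ + lam) T,
      sum_char_eq_card_sub_two_mul hexp χ T₀, hT, hT₀card] at h1
    have h2 : ((a χ : ℂ) + (a (χ + lam) : ℂ)) = 8 + 2 * (a₀ χ : ℂ) := by
      simp only [ha, ha₀]
      linear_combination (-1 : ℂ) / 2 * h1
    exact_mod_cast h2
  -- odd characters are permuted by `χ ↦ χλ`
  have hoddl : ∀ χ, χ (Additive.ofMul ρ) = -1 → (χ + lam) (Additive.ofMul ρ) = -1 := fun χ hχ => by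
    rw [AddChar.add_apply, hχ, hlρ, mul_one]
  have hll := add_self_eq_zero_char hexp lam
  have hinvol : ∀ χ : AddChar (Additive G) ℂ, χ + lam + lam = χ := fun χ => by rw [add_assoc, hll, add_zero]
  -- `a₀(χ₁)` is odd, hence every `a₀(χ)` is odd
  have h16 : 16 ∣ Fintype.card G := ⟨2, by rw [h32]⟩
  have hchi1l : χ₁ + lam = χ₂ := by rw [hlam, ← add_assoc, add_self_eq_zero_char hexp χ₁, zero_add]
  have ha₀odd : ∀ χ, χ (Additive.ofMul ρ) = -1 → a₀ χ % 2 = 1 := by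
    intro χ hχ
    have hbal : a₀ χ % 2 = a₀ χ₁ % 2 := by
      have := card_filter_filter_mod_two_eq hexp h h16 hlρ hl0 hχ hχ₁ρ
      rw [← hT₀] at this
      exact this
    have h1 := hpair χ₁
    rw [hchi1l] at h1
    have he1 := hev' χ₁ hχ₁ρ
    have he2 := hev' χ₂ hχ₂ρ
    rw [Nat.even_iff] at he1 he2
    omega
  -- hence the residues alternate along every `λ`-pair
  have halt : ∀ χ, χ (Additive.ofMul ρ) = -1 → (a χ % 4 = 2 ↔ a (χ + lam) % 4 ≠ 2) := by
    intro χ hχ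
    have h1 := hpair χ
    have h2 := ha₀odd χ hχ
    have he1 := hev' χ hχ
    have he2 := hev' (χ + lam) (hoddl χ hχ)
    rw [Nat.even_iff] at he1 he2
    omega
  -- `χ ↦ χλ` maps `O₂` into `O ∖ O₂` and back: equal cards
  have hmaps₁ : ∀ χ ∈ O₂, χ + lam ∈ O \ O₂ := by
    intro χ hχ
    obtain ⟨hχO, hχ2⟩ := Finset.mem_filter.1 hχ
    have hχρ := (hmemO χ).1 hχO
    refine Finset.mem_sdiff.2 ⟨(hmemO _).2 (hoddl χ hχρ), fun hmem => ?_⟩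
    exact ((halt χ hχρ).1 hχ2) (Finset.mem_filter.1 hmem).2
  have hmaps₂ : ∀ χ ∈ O \ O₂, χ + lam ∈ O₂ := by
    intro χ hχ
    obtain ⟨hχO, hχ2⟩ := Finset.mem_sdiff.1 hχ
    have hχρ := (hmemO χ).1 hχO
    have hne2 : a χ % 4 ≠ 2 := fun h2 => hχ2 (Finset.mem_filter.2 ⟨hχO, h2⟩)
    refine Finset.mem_filter.2 ⟨(hmemO _).2 (hoddl χ hχρ), ?_⟩
    by_contra hne
    exact hne2 (by
      have := (halt (χ + lam) (hoddl χ hχρ)).2 (by rw [hinvol]; exact hne2)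
      exact absurd this hne)
  have hinj : ∀ s : Finset (AddChar (Additive G) ℂ), Set.InjOn (fun χ => χ + lam) s :=
    fun s χ _ χ' _ hh => add_right_cancel hh
  have hle₁ : O₂.card ≤ (O \ O₂).card :=
    Finset.card_le_card_of_injOn (fun χ => χ + lam) hmaps₁ (hinj O₂)
  have hle₂ : (O \ O₂).card ≤ O₂.card :=
    Finset.card_le_card_of_injOn (fun χ => χ + lam) hmaps₂ (hinj _)
  have hsd : (O \ O₂).card = O.card - O₂.card := Finset.card_sdiff_of_subset hsub
  have hle : O₂.card ≤ O.card := Finset.card_le_card hsub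
  omega

/-- **ON A GROUP OF EXPONENT `2` AND ORDER `32`, EVERY CM TYPE HAS KUBOTA RANK `17`, `11`, `9`, `5` OR `2`** — the
multiquadratic CM fields of degree `32` (`g = 16`).  Odd types: `17` (tree).  Even types: with `n_v = #{χ odd :
(8 − a_χ)² = v}`, Parseval gives `16n₆₄ + 9n₃₆ + 4n₁₆ + n₄ = 16`, the balance gives `n₃₆ + n₄ ∈ {0, 8, 16}`, and
the survivors are the `16 − n₀` characters with `a_χ ≠ 8`. [cite: Kubota1965, §4 Lemma 2] [cite: Dodson1984, §3.1.1 Theorem]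
[cite: Carlet2020, §2.3 (2.51) (p. 61)] -/
theorem typeRank_mem_of_card_thirtytwo (hexp : ∀ g : G, g ^ 2 = 1) (h : IsCMTypeWith ρ (T : Set G))
    (h32 : Fintype.card G = 32) :
    typeRank G (T : Set G) = 17 ∨ typeRank G (T : Set G) = 11 ∨ typeRank G (T : Set G) = 9 ∨
      typeRank G (T : Set G) = 5 ∨ typeRank G (T : Set G) = 2 := by
  have hT : T.card = 16 := by have := two_mul_card_tt h; omega
  obtain ⟨χ₀, hχ₀, -⟩ := exists_odd_sum_char_ne_zero hexp h
  rcases Nat.even_or_odd (T.filter fun s => χ₀ (Additive.ofMul s) = -1).card with hev₀ | hodd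
  swap
  · left
    rw [typeRank_eq_of_odd hexp h (by rw [h32]; norm_num) hχ₀ hodd, h32]
  -- even type: all sign counts are even
  have hev : ∀ χ : AddChar (Additive G) ℂ, χ (Additive.ofMul ρ) = -1 →
      Even (T.filter fun s => χ (Additive.ofMul s) = -1).card := by
    intro χ hχ
    have hpar := card_filter_mod_two_eq hexp h (by rw [h32]; norm_num) hχ₀ hχ
    rw [Nat.even_iff] at hev₀ ⊢
    omega
  set O := Finset.univ.filter (fun χ : AddChar (Additive G) ℂ => χ (Additive.ofMul ρ) = -1) with hO
  set a : AddChar (Additive G) ℂ → ℕ := fun χ => (T.filter fun s => χ (Additive.ofMul s) = -1).card with ha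
  have hOcard : O.card = 16 := by
    have := two_mul_card_odd_eq (T := T) h; rw [← hO, h32] at this; omega
  have hmemO : ∀ χ, χ ∈ O ↔ χ (Additive.ofMul ρ) = -1 := fun χ => by
    rw [hO, Finset.mem_filter]; exact ⟨fun hh => hh.2, fun hh => ⟨Finset.mem_univ _, hh⟩⟩
  have hev' : ∀ χ : AddChar (Additive G) ℂ, χ (Additive.ofMul ρ) = -1 → Even (a χ) := hev
  have hale : ∀ χ, a χ ≤ 16 := fun χ => by rw [← hT]; exact Finset.card_filter_le _ _
  -- the value classes
  set n64 := (O.filter fun χ => a χ = 0 ∨ a χ = 16).card with hn64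
  set n36 := (O.filter fun χ => a χ = 2 ∨ a χ = 14).card with hn36
  set n16 := (O.filter fun χ => a χ = 4 ∨ a χ = 12).card with hn16
  set n4 := (O.filter fun χ => a χ = 6 ∨ a χ = 10).card with hn4
  set n0 := (O.filter fun χ => a χ = 8).card with hn0
  -- Parseval: `Σ_{odd} (16 − 2a)² = 256`
  have hP := sum_odd_sq_eq_int hexp h
  rw [hT] at hP
  have hpt : ∀ χ ∈ O, ((16 : ℤ) - 2 * (a χ : ℤ)) ^ 2 =
      256 * (if a χ = 0 ∨ a χ = 16 then 1 else 0) + 144 * (if a χ = 2 ∨ a χ = 14 then 1 else 0) +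
      64 * (if a χ = 4 ∨ a χ = 12 then 1 else 0) + 16 * (if a χ = 6 ∨ a χ = 10 then 1 else 0) := by
    intro χ hχ
    have hle := hale χ
    obtain ⟨b, hb⟩ := hev' χ ((hmemO χ).1 hχ)
    have hb8 : b ≤ 8 := by omega
    rw [hb]
    interval_cases b <;> norm_num
  have hsumP : ∑ χ ∈ O, ((16 : ℤ) - 2 * (a χ : ℤ)) ^ 2 =
      256 * (n64 : ℤ) + 144 * (n36 : ℤ) + 64 * (n16 : ℤ) + 16 * (n4 : ℤ) := by
    rw [Finset.sum_congr rfl hpt, Finset.sum_add_distrib, Finset.sum_add_distrib, Finset.sum_add_distrib,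
      ← Finset.mul_sum, ← Finset.mul_sum, ← Finset.mul_sum, ← Finset.mul_sum, Finset.sum_boole, Finset.sum_boole,
      Finset.sum_boole, Finset.sum_boole]
  have hP' : ∑ χ ∈ O, ((16 : ℤ) - 2 * (a χ : ℤ)) ^ 2 = 256 := by
    simp only [hO, ha]
    exact_mod_cast hP
  rw [hsumP] at hP'
  -- the partition count
  have hpart : ∀ χ ∈ O, ((if a χ = 0 ∨ a χ = 16 then 1 else 0 : ℕ) + (if a χ = 2 ∨ a χ = 14 then 1 else 0) +
      (if a χ = 4 ∨ a χ = 12 then 1 else 0) + (if a χ = 6 ∨ a χ = 10 then 1 else 0) +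
      (if a χ = 8 then 1 else 0)) = 1 := by
    intro χ hχ
    have hle := hale χ
    obtain ⟨b, hb⟩ := hev' χ ((hmemO χ).1 hχ)
    have hb8 : b ≤ 8 := by omega
    rw [hb]
    interval_cases b <;> norm_num
  have hsum1 : n64 + n36 + n16 + n4 + n0 = 16 := by
    have hs := Finset.sum_congr (rfl : O = O) hpart
    rw [Finset.sum_add_distrib, Finset.sum_add_distrib, Finset.sum_add_distrib, Finset.sum_add_distrib,
      Finset.sum_boole, Finset.sum_boole, Finset.sum_boole, Finset.sum_boole, Finset.sum_boole, Finset.sum_const,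
      smul_eq_mul, mul_one, hOcard] at hs
    simp only [Nat.cast_id] at hs
    exact hs
  -- the balance: `n36 + n4 ∈ {0, 8, 16}`
  have hbal := card_filter_mod_four_mem hexp h h32 hev
  have hO₂ : (O.filter fun χ => a χ % 4 = 2).card = n36 + n4 := by
    rw [hn36, hn4, ← Finset.card_union_of_disjoint (Finset.disjoint_filter.2 fun χ _ h1 h2 => by omega),
      ← Finset.filter_or]
    congr 1
    refine Finset.filter_congr fun χ hχ => ?_
    have hle := hale χ
    obtain ⟨b, hb⟩ := hev' χ ((hmemO χ).1 hχ)
    have hb8 : b ≤ 8 := by omega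
    rw [hb]
    interval_cases b <;> norm_num
  simp only [← hO] at hbal
  rw [hO₂] at hbal
  -- the survivors: `a ≠ 8`
  have hrank := h.typeRank_eq_one_add_ncard_oddCharacters
  rw [ncard_survivors_eq_tt, ← hO] at hrank
  have hsurv : (O.filter fun χ => ∑ s ∈ T, χ (Additive.ofMul s) ≠ 0).card = 16 - n0 := by
    have hcompl : (O.filter fun χ => ∑ s ∈ T, χ (Additive.ofMul s) ≠ 0) = O.filter fun χ => ¬ a χ = 8 := by
      refine Finset.filter_congr fun χ _ => ?_
      rw [Ne, sum_char_eq_zero_iff_two_mul_card_filter_eq hexp χ T, hT]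
      simp only [ha]
      omega
    rw [hcompl, Finset.filter_not, Finset.card_sdiff_of_subset (Finset.filter_subset _ _), hOcard]
  rw [hsurv] at hrank
  have hn0le : n0 ≤ 16 := by rw [hn0, ← hOcard]; exact Finset.card_filter_le _ _
  have e1 : 16 * n64 + 9 * n36 + 4 * n16 + n4 = 16 := by
    clear hpt hpart hsumP hP hrank hsurv
    omega
  have e2 : n64 + n36 + n16 + n4 + n0 = 16 := hsum1
  have e3 : typeRank G (T : Set G) = 1 + (16 - n0) := hrank
  clear hP' hsumP hpt hpart hsurv hrank hO₂
  rcases hbal with hb | hb | hb <;> omega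

/-- **Order `32`: no CM type has rank `6`** (although `256 = 144 + 64 + 3·16` is a Parseval solution).
[cite: Kubota1965, §4 Lemma 2] [cite: Carlet2020, §2.3 (2.51) (p. 61)] -/
theorem typeRank_ne_six_of_card_thirtytwo (hexp : ∀ g : G, g ^ 2 = 1) (h : IsCMTypeWith ρ (T : Set G))
    (h32 : Fintype.card G = 32) : typeRank G (T : Set G) ≠ 6 := by
  rcases typeRank_mem_of_card_thirtytwo hexp h h32 with h1 | h1 | h1 | h1 | h1 <;> omega

/-- **Order `32`: no CM type has rank `8`** (although `256 = 3·64 + 4·16` is a Parseval solution).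
[cite: Kubota1965, §4 Lemma 2] [cite: Carlet2020, §2.3 (2.51) (p. 61)] -/
theorem typeRank_ne_eight_of_card_thirtytwo (hexp : ∀ g : G, g ^ 2 = 1) (h : IsCMTypeWith ρ (T : Set G))
    (h32 : Fintype.card G = 32) : typeRank G (T : Set G) ≠ 8 := by
  rcases typeRank_mem_of_card_thirtytwo hexp h h32 with h1 | h1 | h1 | h1 | h1 <;> omega

/-- **Order `32`: no CM type has rank `14`** (although `256 = 64 + 12·16` is a Parseval solution).
[cite: Kubota1965, §4 Lemma 2] [cite: Carlet2020, §2.3 (2.51) (p. 61)] -/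
theorem typeRank_ne_fourteen_of_card_thirtytwo (hexp : ∀ g : G, g ^ 2 = 1) (h : IsCMTypeWith ρ (T : Set G))
    (h32 : Fintype.card G = 32) : typeRank G (T : Set G) ≠ 14 := by
  rcases typeRank_mem_of_card_thirtytwo hexp h h32 with h1 | h1 | h1 | h1 | h1 <;> omega

/-- **Order `32`: a degenerate CM type has rank at most `11`** (defect `≥ 6`: never `1, …, 5`).
[cite: Kubota1965, §4 Lemma 2] [cite: Dodson1984, §3.1.1 Theorem] -/
theorem typeRank_le_eleven_of_ne_of_card_thirtytwo (hexp : ∀ g : G, g ^ 2 = 1) (h : IsCMTypeWith ρ (T : Set G))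
    (h32 : Fintype.card G = 32) (hne : typeRank G (T : Set G) ≠ 17) : typeRank G (T : Set G) ≤ 11 := by
  rcases typeRank_mem_of_card_thirtytwo hexp h h32 with h1 | h1 | h1 | h1 | h1 <;> omega

end ThirtyTwo

end ExponentTwo

end CyclicCMType

end Literature.NumberTheory.ComplexMultiplication
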